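import Summits.HodgeConjecture.HodgeConjecture.Theorems.F0P3bPPartOperators
import HarnessLib

/-!
# FLOOR-0 P2a — L2C engine-side DICTIONARY: the Cauchy–Riemann null core (`μ = i`) and the weight element
# `2 z₀ − i·1` (the cut's `h₀ = i·J`) in `𝔲(α, β)` coordinates

Cell hodgecm-mathlib (FLOOR 0), crux item H413 = stmt-HodgeConjecture-24833, programme P2a, stub S2⁺ of
`Cruxes/H413/Lines/F0_P2aCohIsotypicLine.lean`, piece L2C (desk rulings v3.1 (R2)∕(R3): ENGINE = A-p08 (g15)
`Theorems/F0P2aL2cPNullSpanOrthogonal.lean`; CONSUMER = F0P2a-p08 (g0) `Theorems/F0P2aL2cOrderedProducts.lean`).  Author A-p08 (g15).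
PROOF lane (theorems only; no `def`, no instance, no notation, no named fact, no `sorry`).  HC_CM is proved only modulo the 7 printed
citations until rung 0 closes; this file proves nothing about them.

WHAT THIS FILE SUPPLIES (all in the engine's coordinates `ρ𝔤 : 𝔲(α,β) →ₗ⁅ℝ⁆ End_ℂ W`, so the consumer's reindex `Fin 3 ≃ Fin 2 ⊕ Fin 1` meets
ready-made hypotheses):
* §1 (CR ⇒ null core, `μ = i`): if `ρ𝔤 (X_{i c}) e = i • ρ𝔤 (X_c) e` on `E` for the matrix-unit directions `X_c = upqUnit p c` (the
  complex-linear Cauchy–Riemann form of `sig_L2C`), then `E` is `pOp ρ𝔤 i`-null on the frame `upqPBasis` and on all of `𝔭` (`hEn`).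
* §2 (the weight element): `i·1 ∈ 𝔲(α,β)` is central, `2 z₀ − i·1` has matrix `fromBlocks (i·1) 0 0 (−i·1)` (`= i·diag(1_α, −1_β)`, the
  reindexed `i·J`) and satisfies `⁅2 z₀ − i·1, Y⁆ = 2 • ⁅z₀, Y⁆` — the hypothesis `hh` (`r = 2`) of the engine's weight statements.

References: [BorelWallach2000] A. Borel, N. Wallach, *Continuous cohomology, discrete subgroups, and representations of reductive groups*
(2000), II §4.1; [Knapp2002] A. W. Knapp, *Lie Groups Beyond an Introduction* (2002), I §1 Example (3) (`𝔲(p,q)` in blocks).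
-/

-- Mathlib idiom (as in the engine files): the commutator bracket on `Module.End ℂ W`
attribute [local instance 100] LieRing.ofAssociativeRing

set_option autoImplicit false
set_option linter.dupNamespace false

noncomputable section

namespace Summit.HodgeConjecture.HodgeConjecture.Cruxes.H413.F0P2aL2cEngineDictionary

open Literature.RepresentationTheory.BorelWallach2000
open Literature.RepresentationTheory.KonnoKonno2007 Literature.RepresentationTheory.KonnoKonno2007.RealDualPair
open Literature.RepresentationTheory.KonnoKonno2007.RealDualPair.UForm
open Summit.HodgeConjecture.HodgeConjecture.Cruxes.H413.F0P3bPPartOperators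

variable {α β : Type} [Fintype α] [DecidableEq α] [Fintype β] [DecidableEq β]

/-! ## §1 The complex-linear Cauchy–Riemann relation makes `E` a `pOp ρ𝔤 i`-null core -/

section CR

variable {W : Type} [AddCommGroup W] [Module ℂ W] {ρ𝔤 : (uFormGroup α β).lie →ₗ⁅ℝ⁆ Module.End ℂ W}

/-- **CR ⇒ nullity on the matrix-unit directions**: if `ρ𝔤 X_{i c} e = i • ρ𝔤 X_c e` then `pOp ρ𝔤 i X_c e = ρ𝔤 X_c e + i • ρ𝔤 ⁅z₀, X_c⁆ e = 0`
(`⁅z₀, X_c⁆ = X_{i c}`, ★ `lie_upqZ0_upqUnit`; `i·i = −1`). [cite: BorelWallach2000, II §4.1] -/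
theorem pOp_I_upqUnit_eq_zero (p : α × β) (c : ℂ) {e : W}
    (hCR : ρ𝔤 (upqUnit p (Complex.I * c)) e = Complex.I • ρ𝔤 (upqUnit p c) e) :
    pOp ρ𝔤 Complex.I (upqUnit p c) e = 0 := by
  rw [pOp_apply, lie_upqZ0_upqUnit, hCR, smul_smul, Complex.I_mul_I, neg_one_smul, add_neg_cancel]

/-- **CR on `E` ⇒ `E` is `pOp ρ𝔤 i`-null on the frame `(x_s)`** — the hypothesis `hEn` (with `μ = i`) of the engine
`F0P3bPNullGeneration` ∕ `F0P2aL2cPNullSpanOrthogonal` (`x_s = upqUnit s.1 (upqPCoeff s.2)`). [cite: BorelWallach2000, II §4.1] -/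
theorem pNull_of_CR {E : Submodule ℂ W}
    (hCR : ∀ (p : α × β) (c : ℂ), ∀ e ∈ E, ρ𝔤 (upqUnit p (Complex.I * c)) e = Complex.I • ρ𝔤 (upqUnit p c) e) :
    ∀ e ∈ E, ∀ s : (α × β) × Fin 2, pOp ρ𝔤 Complex.I (upqPBasis s) e = 0 :=
  fun e he s => pOp_I_upqUnit_eq_zero s.1 (upqPCoeff s.2) (hCR s.1 _ e he)

/-- **CR on `E` ⇒ `pOp ρ𝔤 i X` kills `E` for every `X ∈ 𝔭`** (`𝔭 = Σ_s ℝ x_s`). [cite: BorelWallach2000, II §4.1] -/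
theorem pOp_I_eq_zero_of_CR {E : Submodule ℂ W}
    (hCR : ∀ (p : α × β) (c : ℂ), ∀ e ∈ E, ρ𝔤 (upqUnit p (Complex.I * c)) e = Complex.I • ρ𝔤 (upqUnit p c) e)
    (X : (uFormGroup α β).lie) (hX : X ∈ pPart α β) {e : W} (he : e ∈ E) : pOp ρ𝔤 Complex.I X e = 0 := by
  obtain ⟨a, rfl⟩ := exists_sum_upqPBasis_of_mem_pPart X hX
  rw [pOp_sum_smul_apply]
  exact Finset.sum_eq_zero fun s _ => by rw [pNull_of_CR hCR e he s, smul_zero]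

/-- `i` is a legitimate nullity parameter: `i · i = −1`. [folklore] -/
theorem I_mul_I_eq : Complex.I * Complex.I = -1 := Complex.I_mul_I

end CR

/-! ## §2 The central element `i·1` and the weight element `2 z₀ − i·1` (the reindexed `i·J`) -/

section WeightElement

/-- `i·1 ∈ 𝔲(α, β)` (`(i·1)ᴴ D + D (i·1) = −i D + i D = 0`). [cite: Knapp2002, I §1 Example (3)] -/
theorem I_smul_one_mem_lie : Complex.I • (1 : Matrix (α ⊕ β) (α ⊕ β) ℂ) ∈ (uFormGroup α β).lie := by
  rw [← Matrix.fromBlocks_one, Matrix.fromBlocks_smul, smul_zero, smul_zero, upq_fromBlocks_mem_lie_iff]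
  refine ⟨?_, ?_, ?_⟩
  · rw [Matrix.conjTranspose_smul, Matrix.conjTranspose_one, Complex.star_def, Complex.conj_I, neg_smul]
  · rw [Matrix.conjTranspose_smul, Matrix.conjTranspose_one, Complex.star_def, Complex.conj_I, neg_smul]
  · rw [Matrix.conjTranspose_zero]

/-- **`i·1` is central in `𝔲(α, β)`.** [folklore] -/
theorem lie_I_smul_one_eq_zero (Y : (uFormGroup α β).lie) :
    ⁅(⟨Complex.I • (1 : Matrix (α ⊕ β) (α ⊕ β) ℂ), I_smul_one_mem_lie⟩ : (uFormGroup α β).lie), Y⁆ = 0 := by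
  apply Subtype.ext
  rw [LieSubalgebra.coe_bracket, Ring.lie_def, ZeroMemClass.coe_zero, Matrix.smul_mul, Matrix.mul_smul, Matrix.one_mul,
    Matrix.mul_one, sub_self]

/-- **Central shifts do not change brackets**: `⁅r • z₀ + z, Y⁆ = r • ⁅z₀, Y⁆` for central `z` — the hypothesis `hh` of the engine's
weight statements. [folklore] -/
theorem lie_eq_smul_lie_of_central {z : (uFormGroup α β).lie} (hz : ∀ Y : (uFormGroup α β).lie, ⁅z, Y⁆ = 0) (r : ℝ)
    (Y : (uFormGroup α β).lie) : ⁅r • upqZ0 α β + z, Y⁆ = r • ⁅upqZ0 α β, Y⁆ := by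
  rw [add_lie, smul_lie, hz Y, add_zero]

/-- **The weight element `2 z₀ − i·1` satisfies `⁅2 z₀ − i·1, Y⁆ = 2 • ⁅z₀, Y⁆`** (`r = 2` in the engine). [cite: BorelWallach2000, II §4.1] -/
theorem lie_two_smul_upqZ0_sub_I (Y : (uFormGroup α β).lie) :
    ⁅(2 : ℝ) • upqZ0 α β - ⟨Complex.I • (1 : Matrix (α ⊕ β) (α ⊕ β) ℂ), I_smul_one_mem_lie⟩, Y⁆ = (2 : ℝ) • ⁅upqZ0 α β, Y⁆ := by
  rw [sub_lie, smul_lie, lie_I_smul_one_eq_zero, sub_zero]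

/-- **The matrix of `2 z₀ − i·1` is `fromBlocks (i·1) 0 0 (−i·1) = i · diag(1_α, −1_β)`** — under `Fin 2 ⊕ Fin 1 ≃ Fin 3` this is the
cut's `h₀ = i·J`, `J = diag(1,1,−1)`. [cite: BorelWallach2000, II §4.1] -/
theorem coe_two_smul_upqZ0_sub_I :
    (((2 : ℝ) • upqZ0 α β - ⟨Complex.I • (1 : Matrix (α ⊕ β) (α ⊕ β) ℂ), I_smul_one_mem_lie⟩ : (uFormGroup α β).lie) :
      Matrix (α ⊕ β) (α ⊕ β) ℂ) = Matrix.fromBlocks (Complex.I • (1 : Matrix α α ℂ)) 0 0 (-(Complex.I • (1 : Matrix β β ℂ))) := by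
  have h2 : ((((2 : ℝ) • upqZ0 α β : (uFormGroup α β).lie)) : Matrix (α ⊕ β) (α ⊕ β) ℂ) =
      (2 : ℝ) • ((upqZ0 α β : (uFormGroup α β).lie) : Matrix (α ⊕ β) (α ⊕ β) ℂ) := rfl
  have h3 : ((⟨Complex.I • (1 : Matrix (α ⊕ β) (α ⊕ β) ℂ), I_smul_one_mem_lie⟩ : (uFormGroup α β).lie) :
      Matrix (α ⊕ β) (α ⊕ β) ℂ) = Complex.I • (1 : Matrix (α ⊕ β) (α ⊕ β) ℂ) := rfl
  rw [AddSubgroupClass.coe_sub, h2, h3, coe_upqZ0, ← Matrix.fromBlocks_one, Matrix.fromBlocks_smul,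
    Matrix.fromBlocks_smul, sub_eq_add_neg, Matrix.fromBlocks_neg, Matrix.fromBlocks_add]
  simp only [smul_zero, add_zero, neg_zero, zero_add]
  congr 1
  rw [← Complex.coe_smul, smul_smul, ← sub_eq_add_neg, ← sub_smul, Complex.ofReal_ofNat, two_mul, add_sub_cancel_right]

/-- The same matrix is `i • diag(1_α, −1_β) = i • signForm α β`. [cite: Knapp2002, I §1 Example (3)] -/
theorem coe_two_smul_upqZ0_sub_I_eq_smul_signForm :
    (((2 : ℝ) • upqZ0 α β - ⟨Complex.I • (1 : Matrix (α ⊕ β) (α ⊕ β) ℂ), I_smul_one_mem_lie⟩ : (uFormGroup α β).lie) :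
      Matrix (α ⊕ β) (α ⊕ β) ℂ) = Complex.I • RealDualPair.signForm α β := by
  rw [coe_two_smul_upqZ0_sub_I, RealDualPair.signForm, Matrix.fromBlocks_smul, smul_zero, smul_zero, smul_neg]

end WeightElement

end Summit.HodgeConjecture.HodgeConjecture.Cruxes.H413.F0P2aL2cEngineDictionary

end
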